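import Literature.NumberTheory.EllipticCurves.KleinJCuspExpansionSecondOrderWide
import Literature.NumberTheory.EllipticCurves.ClassPolynomialNegTwoThirtyFive
import HarnessLib

/-!
# Discriminant `−91`, part 1: the Heegner nomes (one of them NON-real), the cusp windows to first and SECOND order, and the
# integer windows for `j₁ + j₂`, `j₁j₂`

certified instances and evidence bearing on the general Hodge conjecture; no claim.

Topic `NumberTheory/EllipticCurves` (singular moduli); theorem-only file (no definition, no named fact; D-0026), in the tree's vocabulary
`classPolynomial D`, `reducedForms D`, `formJ Q = j(τ_Q)`, `heegnerTau` (`D = −91 = −7·13`, fundamental, class number 2, `7` and `13` ramified).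
The level-7 route of `ClassPolynomialNegFourTwentySeven` transposes to `D = −91` (the ramified prime over `7` lies in the class of order 2:
`(7,7,5) ~ (5,3,5)`), with ONE analytic difference handled here: the reduced point `τ₂ = τ_{(5,3,5)} = (−3 + i√91)/10` lies ON the unit circle,
its nome `q₂ = e^{−3πi/5}·e^{−π√91/5}` is NOT real and has modulus `1/400.93`, outside the first-order cusp lemmas; the SECOND-order estimate
`KleinJCuspExpansionSecondOrderWide` (‖q‖ ≤ 1/400, constant 3.3·10⁷) bounds `‖j₂ − 1/q₂ − 744 − 196884q₂‖ ≤ 205.31`, and taking REAL PARTS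
against the integer trace `S = j₁ + j₂` (with `j₁ = −e^{π√91} + 744 + O(10⁻⁶)` real up to `10⁻⁶`) gives
`|S + F⁵ − 1488 − (F + 196884/F)·cos(3π/5)| ≤ 205.32`, `F = e^{π√91/5} ∈ [400.9259, 400.9261]` (kernel pin), `cos(3π/5) = (1 − √5)/4`
(Mathlib's `Real.cos_pi_div_five`), whence the integer windows of `trace_norm_window`.
PRINTED target (part 2): `H_{−91}(X) = X² + 10359073013760·X − 3845689020776448` [LeprevostEtAl2005, p. 229, row 91].
References: [GranvilleStark2000] §2 (`|1/q| = e^{π√d/a}`); [Cox2013] Thm. 2.13, §11.A Thm. 11.8, §13.A Prop. 13.2. -/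

noncomputable section

open Complex Polynomial
open UpperHalfPlane hiding I
open scoped Real

namespace Literature.NumberTheory.EllipticCurves

open ModularForms
open Literature.NumberTheory.EllipticCurves.ModularForms (norm_E₄_cube_div_discriminant_sub_sub_le
  norm_E₄_cube_div_discriminant_sub_sub_sub_le_second_wide)
open Literature.NumberTheory.QuadraticFields.BinaryQuadraticForm (reducedForms mem_reducedForms_iff)
open Literature.NumberTheory.QuadraticFields.Quadratic (BinQF)

namespace ClassPolynomialNegNinetyOne

/-- `√(−(−91)) = √91`. [folklore] -/
private theorem sqrt_neg_neg : Real.sqrt (-((-91 : ℤ) : ℝ)) = √(91 : ℝ) := by norm_num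

/-- **The nome at `τ₂ = τ_{(5,3,5)} = (−3 + i√91)/10` is `e^{−π√91/5}·e^{−3πi/5}`** (modulus `e^{−π√91/5} = 1/400.93`, argument `−3π/5`).
[cite: GranvilleStark2000, §2 proof of Theorem 1 (`|1/q| = e^{π√d/a}`, `a = 5`)] -/
theorem qParam_heegnerTau_five_three_five :
    Function.Periodic.qParam 1 (heegnerTau (5, 3, 5) : ℂ) =
      (Real.exp (-(π * √(91 : ℝ) / 5)) : ℂ) * cexp (((-(3 * π / 5) : ℝ) : ℂ) * Complex.I) := by
  rw [qParam_one_eq_cexp, coe_heegnerTau_eq (Q := ((5 : ℤ), (3 : ℤ), (5 : ℤ))) (D := -91) (by norm_num) (by norm_num) (by norm_num),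
    sqrtDisc, sqrt_neg_neg]
  have harg : 2 * (π : ℂ) * Complex.I * ((Complex.I * (√(91 : ℝ) : ℂ) - ((3 : ℤ) : ℂ)) / (2 * ((5 : ℤ) : ℂ))) =
      ((-(π * √(91 : ℝ) / 5) : ℝ) : ℂ) + ((-(3 * π / 5) : ℝ) : ℂ) * Complex.I := by
    push_cast
    linear_combination ((π : ℂ) * (√(91 : ℝ) : ℂ) / 5) * Complex.I_mul_I
  rw [harg, Complex.exp_add, ← Complex.ofReal_exp]

/-- `‖q₂‖ = e^{−π√91/5}`. [cite: GranvilleStark2000, §2 proof of Theorem 1] -/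
theorem norm_qParam_heegnerTau_five_three_five :
    ‖Function.Periodic.qParam 1 (heegnerTau (5, 3, 5) : ℂ)‖ = Real.exp (-(π * √(91 : ℝ) / 5)) := by
  rw [qParam_heegnerTau_five_three_five, norm_mul, Complex.norm_real, Real.norm_eq_abs, abs_of_pos (Real.exp_pos _),
    Complex.norm_exp_ofReal_mul_I, mul_one]

/-- **The nome at `τ₁ = τ_{(1,1,23)} = (−1 + i√91)/2` is the negative real `−e^{−π√91}`.** [cite: GranvilleStark2000, §2 proof of Theorem 1 (`|1/q| = e^{π√d}`)] -/
theorem qParam_heegnerTau_one_one_twentyThree :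
    Function.Periodic.qParam 1 (heegnerTau (1, 1, 23) : ℂ) = -(Real.exp (-(π * √(91 : ℝ))) : ℂ) := by
  rw [qParam_one_eq_cexp, coe_heegnerTau_eq (Q := ((1 : ℤ), (1 : ℤ), (23 : ℤ))) (D := -91) (by norm_num) (by norm_num) (by norm_num),
    sqrtDisc, sqrt_neg_neg]
  have harg : 2 * (π : ℂ) * Complex.I * ((Complex.I * (√(91 : ℝ) : ℂ) - ((1 : ℤ) : ℂ)) / (2 * ((1 : ℤ) : ℂ))) =
      ((-(π * √(91 : ℝ)) : ℝ) : ℂ) - π * Complex.I := by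
    push_cast
    linear_combination ((π : ℂ) * (√(91 : ℝ) : ℂ)) * Complex.I_mul_I
  rw [harg, Complex.exp_sub, Complex.exp_pi_mul_I, ← Complex.ofReal_exp, div_neg, div_one]

/-- `e^{π√91} = (e^{π√91/5})⁵`. [folklore] -/
private theorem exp_pi_sqrt_eq_pow : Real.exp (π * √(91 : ℝ)) = Real.exp (π * √(91 : ℝ) / 5) ^ 5 := by
  rw [← Real.exp_nat_mul]; congr 1; ring

/-- **The numeric pin `400.9259 ≤ e^{π√91/5} ≤ 400.9261`** (true value `400.925960…`): `Real.pi_gt_d20`/`pi_lt_d20` and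
`9.539392014169 < √91 < 9.53939201417` give `5.9937767742 ≤ π√91/5 ≤ 5.9937767743`; `e^x = (e¹)⁵·e^{x−5}` with `Real.exp_one_gt_d9`/`lt_d9`
and thirteen Taylor terms (`Real.exp_bound`). [folklore] -/
private theorem exp_bounds : (400.9259 : ℝ) ≤ Real.exp (π * √(91 : ℝ) / 5) ∧ Real.exp (π * √(91 : ℝ) / 5) ≤ 400.9261 := by
  have hs1 : (9.539392014169 : ℝ) < √(91 : ℝ) := (Real.lt_sqrt (by norm_num)).mpr (by norm_num)
  have hs2 : √(91 : ℝ) < 9.53939201417 := (Real.sqrt_lt' (by norm_num)).mpr (by norm_num)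
  have hπ1 : (3.14159265358979323846 : ℝ) < π := Real.pi_gt_d20
  have hπ2 : π < 3.14159265358979323847 := Real.pi_lt_d20
  have hx1 : (5.9937767742 : ℝ) ≤ π * √(91 : ℝ) / 5 := by nlinarith [mul_nonneg (sub_nonneg.mpr hπ1.le) (sub_nonneg.mpr hs1.le)]
  have hx2 : π * √(91 : ℝ) / 5 ≤ 5.9937767743 := by nlinarith [mul_nonneg (sub_nonneg.mpr hπ2.le) (sub_nonneg.mpr hs2.le)]
  have he1 : (2.7182818283 : ℝ) < Real.exp 1 := Real.exp_one_gt_d9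
  have he2 : Real.exp 1 < (2.7182818286 : ℝ) := Real.exp_one_lt_d9
  have h5pos := pow_pos (Real.exp_pos (1 : ℝ)) 5
  constructor
  · refine le_trans ?_ (Real.exp_le_exp.mpr hx1)
    have hsplit : Real.exp (5.9937767742 : ℝ) = Real.exp 1 ^ 5 * Real.exp (0.9937767742 : ℝ) := by
      rw [← Real.exp_nat_mul, ← Real.exp_add]; norm_num
    have hy : |(0.9937767742 : ℝ)| ≤ 1 := by rw [abs_of_pos (by norm_num)]; norm_num
    have hT := Real.exp_bound hy (n := 13) (by norm_num)
    simp only [Finset.sum_range_succ, Finset.sum_range_zero, Nat.factorial, Nat.succ_eq_add_one] at hT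
    norm_num at hT
    have h5 : (2.7182818283 : ℝ) ^ 5 ≤ Real.exp 1 ^ 5 := pow_le_pow_left₀ (by norm_num) he1.le 5
    rw [hsplit]; nlinarith [(abs_sub_le_iff.1 hT).2, Real.exp_pos (0.9937767742 : ℝ)]
  · refine le_trans (Real.exp_le_exp.mpr hx2) ?_
    have hsplit : Real.exp (5.9937767743 : ℝ) = Real.exp 1 ^ 5 * Real.exp (0.9937767743 : ℝ) := by
      rw [← Real.exp_nat_mul, ← Real.exp_add]; norm_num
    have hy : |(0.9937767743 : ℝ)| ≤ 1 := by rw [abs_of_pos (by norm_num)]; norm_num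
    have hT := Real.exp_bound hy (n := 13) (by norm_num)
    simp only [Finset.sum_range_succ, Finset.sum_range_zero, Nat.factorial, Nat.succ_eq_add_one] at hT
    norm_num at hT
    have h5 : Real.exp 1 ^ 5 ≤ (2.7182818286 : ℝ) ^ 5 := pow_le_pow_left₀ (Real.exp_pos _).le he2.le 5
    rw [hsplit]; nlinarith [(abs_sub_le_iff.1 hT).1, Real.exp_pos (0.9937767743 : ℝ)]

/-- **`‖j(τ_{(5,3,5)}) − 1/q₂ − 744 − 196884·q₂‖ ≤ 3.3·10⁷·e^{−2π√91/5}`**: the tree's SECOND-order cusp estimate on `‖q‖ ≤ 1/400` at `τ₂`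
(`‖q₂‖ = e^{−π√91/5} = 1/400.93`). [cite: Cox2013, §11.A Thm. 11.8 (`j = 1/q + 744 + 196884q + ⋯`)] -/
theorem norm_formJ_five_three_five_sub_le :
    ‖formJ (5, 3, 5) - (Function.Periodic.qParam 1 (heegnerTau (5, 3, 5) : ℂ))⁻¹ - 744 -
        196884 * Function.Periodic.qParam 1 (heegnerTau (5, 3, 5) : ℂ)‖ ≤ 33000000 * Real.exp (-(π * √(91 : ℝ) / 5)) ^ 2 := by
  have hqn := norm_qParam_heegnerTau_five_three_five
  have hq4 : ‖Function.Periodic.qParam 1 (heegnerTau (5, 3, 5) : ℂ)‖ ≤ 1 / 400 := by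
    rw [hqn, Real.exp_neg, inv_le_comm₀ (Real.exp_pos _) (by norm_num), show (1 / (400 : ℝ))⁻¹ = 400 by norm_num]
    linarith [exp_bounds.1]
  have hj : formJ (5, 3, 5) = ModularForm.E₄ (heegnerTau (5, 3, 5)) ^ 3 / ModularForm.discriminant (heegnerTau (5, 3, 5)) := by
    rw [formJ_eq_kleinJ]; rfl
  have hcusp := norm_E₄_cube_div_discriminant_sub_sub_sub_le_second_wide (heegnerTau (5, 3, 5)) hq4
  rw [← hj, hqn] at hcusp
  exact hcusp

/-- **`|j(τ_{(1,1,23)}) + e^{π√91} − 744| ≤ 4·10⁵·e^{−π√91}`**: the first-order cusp estimate at `τ₁`. [cite: GranvilleStark2000, §2 proof of Theorem 1] -/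
theorem norm_formJ_one_one_twentyThree_add_le :
    ‖formJ (1, 1, 23) + (Real.exp (π * √(91 : ℝ)) : ℂ) - 744‖ ≤ 400000 * Real.exp (-(π * √(91 : ℝ))) := by
  have hq := qParam_heegnerTau_one_one_twentyThree
  have hqn : ‖Function.Periodic.qParam 1 (heegnerTau (1, 1, 23) : ℂ)‖ = Real.exp (-(π * √(91 : ℝ))) := by
    rw [hq, norm_neg, Complex.norm_real, Real.norm_eq_abs, abs_of_pos (Real.exp_pos _)]
  have hE4 : (10 ^ 4 : ℝ) ≤ Real.exp (π * √(91 : ℝ)) := by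
    rw [exp_pi_sqrt_eq_pow]; exact le_trans (by norm_num) (pow_le_pow_left₀ (by norm_num) exp_bounds.1 5)
  have hq4 : ‖Function.Periodic.qParam 1 (heegnerTau (1, 1, 23) : ℂ)‖ ≤ 1 / 10 ^ 4 := by
    rwa [hqn, Real.exp_neg, inv_le_comm₀ (Real.exp_pos _) (by norm_num), show (1 / (10 : ℝ) ^ 4)⁻¹ = 10 ^ 4 by norm_num]
  have hj : formJ (1, 1, 23) = ModularForm.E₄ (heegnerTau (1, 1, 23)) ^ 3 / ModularForm.discriminant (heegnerTau (1, 1, 23)) := by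
    rw [formJ_eq_kleinJ]; rfl
  have hcusp := norm_E₄_cube_div_discriminant_sub_sub_le (heegnerTau (1, 1, 23)) hq4
  rw [← hj, hqn, hq, inv_neg, ← Complex.ofReal_inv, Real.exp_neg, inv_inv, sub_neg_eq_add] at hcusp
  rw [Real.exp_neg]; exact hcusp

/-- `cos(3π/5) = (1 − √5)/4` (from Mathlib's `cos(π/5) = (1 + √5)/4`). [folklore] -/
private theorem cos_three_pi_div_five : Real.cos (3 * π / 5) = (1 - √5) / 4 := by
  have h5 : (√(5 : ℝ)) ^ 2 = 5 := Real.sq_sqrt (by norm_num)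
  rw [show 3 * π / 5 = π - 2 * (π / 5) by ring, Real.cos_pi_sub, Real.cos_two_mul, Real.cos_pi_div_five]
  linear_combination (-1 / 8 : ℝ) * h5

/-- `reducedForms (−91) = {(1,1,23), (5,3,5)}` (`h(−91) = 2`). [cite: Cox2013, Thm. 2.13] -/
theorem reducedForms_neg_91 : reducedForms (-91) = {((1 : ℤ), (1 : ℤ), (23 : ℤ)), (5, 3, 5)} := by decide +kernel

/-- **`H_{−91}` is the image in `ℂ[X]` of `minpoly_ℤ(j(τ_{(1,1,23)}))`.** [cite: Cox2013, §13.A Prop. 13.2 (with Thm. 11.1 (i))] -/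
theorem classPolynomial_neg_91_eq_map_minpoly_int :
    classPolynomial (-91) = (minpoly ℤ (formJ (1, 1, 23))).map (algebraMap ℤ ℂ) := by
  have hD : (-91 : ℤ) < 0 := by norm_num
  have hint : IsIntegral ℤ (formJ (1, 1, 23)) :=
    isIntegral_int_formJ (Q := ((1 : ℤ), (1 : ℤ), (23 : ℤ))) (by decide) (by decide) (by decide)
  have hmin := minpoly_formJ_map_eq_classPolynomial (D := -91) (Q := ((1 : ℤ), (1 : ℤ), (23 : ℤ))) hD
    (by rw [reducedForms_neg_91]; simp)
  rw [← hmin, minpoly.isIntegrallyClosed_eq_field_fractions' ℚ hint, Polynomial.map_map]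
  congr 1

/-- **`j₁ + j₂ ∈ ℤ` and `j₁j₂ ∈ ℤ`**: the coefficients of `H_{−91} = (X − j₁)(X − j₂) ∈ ℤ[X]`. [cite: Cox2013, §13.A Prop. 13.2 (with Thm. 11.1 (i))] -/
theorem exists_int_trace_norm :
    ∃ S P : ℤ, formJ (1, 1, 23) + formJ (5, 3, 5) = S ∧ formJ (1, 1, 23) * formJ (5, 3, 5) = P := by
  set M := minpoly ℤ (formJ (1, 1, 23)) with hM
  have h := classPolynomial_neg_91_eq_map_minpoly_int
  rw [classPolynomial, reducedForms_neg_91, Finset.prod_pair (by decide)] at h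
  have hprod : (X - C (formJ (1, 1, 23))) * (X - C (formJ (5, 3, 5))) =
      X ^ 2 - C (formJ (1, 1, 23) + formJ (5, 3, 5)) * X + C (formJ (1, 1, 23) * formJ (5, 3, 5)) := by
    rw [C_add, C_mul]; ring
  rw [hprod] at h
  have h1 := congr_arg (fun p : ℂ[X] => p.coeff 1) h
  have h0 := congr_arg (fun p : ℂ[X] => p.coeff 0) h
  simp only [coeff_add, coeff_sub, coeff_X_pow, coeff_C_mul, coeff_X, coeff_C, coeff_map, eq_intCast] at h1 h0
  norm_num at h1 h0
  refine ⟨-(M.coeff 1), M.coeff 0, ?_, ?_⟩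
  · push_cast; linear_combination -h1
  · exact_mod_cast h0

/-- The REAL-PART bound: for the integer trace `S = j₁ + j₂`, `|S + F⁵ − 1488 − (F + 196884/F)·cos(3π/5)| ≤ 205.310001`
(`F = e^{π√91/5}`): real parts of `(j₁ + F⁵ − 744) + (j₂ − 1/q₂ − 744 − 196884q₂)`, `q₂ = F⁻¹e^{−3πi/5}`. [cite: Cox2013, §11.A Thm. 11.8] -/
private theorem abs_trace_re_le {S : ℤ} (hS : formJ (1, 1, 23) + formJ (5, 3, 5) = S) :
    |(S : ℝ) + Real.exp (π * √(91 : ℝ) / 5) ^ 5 - 1488 -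
      (Real.exp (π * √(91 : ℝ) / 5) + 196884 * (Real.exp (π * √(91 : ℝ) / 5))⁻¹) * Real.cos (-(3 * π / 5))| ≤ 205.310001 := by
  have hw1 := norm_formJ_one_one_twentyThree_add_le
  have hw2 := norm_formJ_five_three_five_sub_le
  rw [qParam_heegnerTau_five_three_five] at hw2
  obtain ⟨hF1, hF2⟩ := exp_bounds
  rw [Real.exp_neg] at hw1 hw2
  rw [exp_pi_sqrt_eq_pow] at hw1
  set F := Real.exp (π * √(91 : ℝ) / 5) with hFdef
  set θ : ℝ := -(3 * π / 5) with hθ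
  have hFpos : 0 < F := Real.exp_pos _
  have hF5 : (400.9259 : ℝ) ^ 5 ≤ F ^ 5 := pow_le_pow_left₀ (by norm_num) hF1 5
  have hF5pos : 0 < F ^ 5 := pow_pos hFpos 5
  have hb1 : 400000 * (F ^ 5)⁻¹ ≤ 1 / 10 ^ 6 := by rw [← div_eq_mul_inv, div_le_iff₀ hF5pos]; nlinarith
  have hb2 : 33000000 * F⁻¹ ^ 2 ≤ 205.31 := by
    rw [inv_pow, ← div_eq_mul_inv, div_le_iff₀ (pow_pos hFpos 2)]; nlinarith
  set c := Real.cos θ with hcdef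
  set s := Real.sin θ with hsdef
  -- the trigonometric form of the nome and of its inverse
  have hexp : cexp (((θ : ℝ) : ℂ) * Complex.I) = (c : ℂ) + (s : ℂ) * Complex.I := by
    rw [Complex.exp_mul_I, ← Complex.ofReal_cos, ← Complex.ofReal_sin]
  have hexpn : cexp (-(((θ : ℝ) : ℂ) * Complex.I)) = (c : ℂ) - (s : ℂ) * Complex.I := by
    rw [show -(((θ : ℝ) : ℂ) * Complex.I) = (-((θ : ℝ) : ℂ)) * Complex.I by ring, Complex.exp_mul_I, Complex.cos_neg, Complex.sin_neg,
      ← Complex.ofReal_cos, ← Complex.ofReal_sin]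
    ring
  have hqinv : (((F⁻¹ : ℝ) : ℂ) * cexp (((θ : ℝ) : ℂ) * Complex.I))⁻¹ = (F : ℂ) * cexp (-(((θ : ℝ) : ℂ) * Complex.I)) := by
    rw [Complex.exp_neg, mul_inv]; push_cast; rw [inv_inv]
  -- the key identity: (j₁ + F⁵ − 744) + (j₂ − 1/q₂ − 744 − 196884 q₂) = ρ + σ·i with ρ, σ REAL
  have hj2 : formJ (5, 3, 5) = (S : ℂ) - formJ (1, 1, 23) := by rw [← hS]; ring
  set ρ : ℝ := (S : ℝ) + F ^ 5 - 1488 - (F + 196884 * F⁻¹) * c with hρ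
  set σ : ℝ := (F - 196884 * F⁻¹) * s with hσ
  have hid : (formJ (1, 1, 23) + ((F ^ 5 : ℝ) : ℂ) - 744) + (formJ (5, 3, 5) - (((F⁻¹ : ℝ) : ℂ) * cexp (((θ : ℝ) : ℂ) * Complex.I))⁻¹ - 744 -
      196884 * (((F⁻¹ : ℝ) : ℂ) * cexp (((θ : ℝ) : ℂ) * Complex.I))) = (ρ : ℂ) + (σ : ℂ) * Complex.I := by
    rw [hqinv, hexpn, hexp, hj2, hρ, hσ]; push_cast; ring
  push_cast at hw1 hw2 hid
  have hre : |ρ| ≤ ‖(ρ : ℂ) + (σ : ℂ) * Complex.I‖ := by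
    have h := Complex.abs_re_le_norm ((ρ : ℂ) + (σ : ℂ) * Complex.I)
    simpa using h
  rw [← hid] at hre
  have hsum := norm_add_le (formJ (1, 1, 23) + (F : ℂ) ^ 5 - 744) (formJ (5, 3, 5) - ((F : ℂ)⁻¹ * cexp ((θ : ℂ) * Complex.I))⁻¹ - 744 -
      196884 * ((F : ℂ)⁻¹ * cexp ((θ : ℂ) * Complex.I)))
  linarith

/-- The REAL windows: `−10359090974488 ≤ S ≤ −10359065136196` and `263.04 ≤ S + F⁵ − 744 ≤ 673.67` (`cos(3π/5) = (1 − √5)/4`,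
`400.9259 ≤ F ≤ 400.9261`). [cite: Cox2013, §11.A Thm. 11.8] -/
private theorem trace_windows {S : ℤ} (hS : formJ (1, 1, 23) + formJ (5, 3, 5) = S) :
    (-10359090974488 : ℤ) ≤ S ∧ S ≤ (-10359065136196 : ℤ) ∧ (263.04 : ℝ) ≤ (S : ℝ) + Real.exp (π * √(91 : ℝ) / 5) ^ 5 - 744 ∧
      (S : ℝ) + Real.exp (π * √(91 : ℝ) / 5) ^ 5 - 744 ≤ 673.67 := by
  have hρabs := abs_trace_re_le hS
  obtain ⟨hF1, hF2⟩ := exp_bounds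
  set F := Real.exp (π * √(91 : ℝ) / 5) with hFdef
  have hFpos : 0 < F := Real.exp_pos _
  have hF5 : (400.9259 : ℝ) ^ 5 ≤ F ^ 5 := pow_le_pow_left₀ (by norm_num) hF1 5
  have hF5hi : F ^ 5 ≤ (400.9261 : ℝ) ^ 5 := pow_le_pow_left₀ hFpos.le hF2 5
  have hinvlo : 1 / 400.9261 ≤ F⁻¹ := by rw [← one_div]; exact one_div_le_one_div_of_le hFpos hF2
  have hinvhi : F⁻¹ ≤ 1 / 400.9259 := by rw [← one_div]; exact one_div_le_one_div_of_le (by norm_num) hF1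
  -- `cos(−3π/5) = (1 − √5)/4 ∈ [−0.309016994375, −0.30901699435]`
  have hcos : Real.cos (-(3 * π / 5)) = (1 - √5) / 4 := by rw [Real.cos_neg, cos_three_pi_div_five]
  have hr1 : (2.2360679774 : ℝ) < √(5 : ℝ) := (Real.lt_sqrt (by norm_num)).mpr (by norm_num)
  have hr2 : √(5 : ℝ) < 2.2360679775 := (Real.sqrt_lt' (by norm_num)).mpr (by norm_num)
  set c := Real.cos (-(3 * π / 5)) with hcdef
  have hc1 : (-0.309016994375 : ℝ) ≤ c := by rw [hcos]; linarith
  have hc2 : c ≤ -0.30901699435 := by rw [hcos]; linarith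
  obtain ⟨hρlo, hρhi⟩ := abs_le.mp hρabs
  -- the product (F + 196884/F)·c with c < 0
  have hMlo : (891.99894 : ℝ) ≤ F + 196884 * F⁻¹ := by linarith
  have hMhi : F + 196884 * F⁻¹ ≤ 891.99939 := by linarith
  have p1 : 0 ≤ (891.99939 - (F + 196884 * F⁻¹)) * (-c) := mul_nonneg (by linarith) (by linarith)
  have p2 : 0 ≤ ((F + 196884 * F⁻¹) - 891.99894) * (-c) := mul_nonneg (by linarith) (by linarith)
  have hMc_lo : 891.99939 * (-0.309016994375) ≤ (F + 196884 * F⁻¹) * c := by nlinarith [p1, hc1]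
  have hMc_hi : (F + 196884 * F⁻¹) * c ≤ 891.99894 * (-0.30901699435) := by nlinarith [p2, hc2]
  have hSlo' : (-10359090974488 : ℝ) ≤ S := by linarith
  have hShi' : (S : ℝ) ≤ -10359065136196 := by linarith
  exact ⟨by exact_mod_cast hSlo', by exact_mod_cast hShi', by linarith, by linarith⟩

/-- **Integer windows for the trace and the norm**: `j₁ + j₂ = S ∈ ℤ`, `j₁j₂ = P ∈ ℤ` with `−10359090974488 ≤ S ≤ −10359065136196` and
`−6978608827319140 ≤ P ≤ −2724848483243186` (so `P < 0`) — REAL PARTS of the second-order estimate at the non-real nome `q₂ = F⁻¹e^{−3πi/5}`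
(`1/q₂ + 196884q₂` has real part `(F + 196884/F)·cos(3π/5)`), the first-order estimate at `q₁ = −F⁻⁵`, `400.9259 ≤ F = e^{π√91/5} ≤ 400.9261`.
[cite: GranvilleStark2000, §2 proof of Theorem 1; Cox2013, §11.A Thm. 11.8, §13.A Prop. 13.2] -/
theorem trace_norm_window : ∃ S P : ℤ, formJ (1, 1, 23) + formJ (5, 3, 5) = S ∧ formJ (1, 1, 23) * formJ (5, 3, 5) = P ∧
    (-10359090974488 : ℤ) ≤ S ∧ S ≤ (-10359065136196 : ℤ) ∧ (-6978608827319140 : ℤ) ≤ P ∧ P ≤ (-2724848483243186 : ℤ) := by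
  obtain ⟨S, P, hS, hP⟩ := exists_int_trace_norm
  obtain ⟨hlo, hhi, htlo, hthi⟩ := trace_windows hS
  have hw1 := norm_formJ_one_one_twentyThree_add_le
  obtain ⟨hF1, hF2⟩ := exp_bounds
  rw [Real.exp_neg, exp_pi_sqrt_eq_pow] at hw1
  set F := Real.exp (π * √(91 : ℝ) / 5) with hFdef
  have hFpos : 0 < F := Real.exp_pos _
  have hF5 : (400.9259 : ℝ) ^ 5 ≤ F ^ 5 := pow_le_pow_left₀ (by norm_num) hF1 5
  have hF5hi : F ^ 5 ≤ (400.9261 : ℝ) ^ 5 := pow_le_pow_left₀ hFpos.le hF2 5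
  have hF5pos : 0 < F ^ 5 := pow_pos hFpos 5
  have hb1 : 400000 * (F ^ 5)⁻¹ ≤ 1 / 10 ^ 6 := by rw [← div_eq_mul_inv, div_le_iff₀ hF5pos]; nlinarith
  push_cast at hw1
  have hz1 : ‖formJ (1, 1, 23) + (F : ℂ) ^ 5 - 744‖ ≤ 1 / 10 ^ 6 := hw1.trans hb1
  -- ‖j₂‖ = ‖(S + F⁵ − 744) − (j₁ + F⁵ − 744)‖
  have hj2' : formJ (5, 3, 5) = (((S : ℝ) + F ^ 5 - 744 : ℝ) : ℂ) - (formJ (1, 1, 23) + (F : ℂ) ^ 5 - 744) := by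
    push_cast; rw [← hS]; ring
  have e1 : ‖((((S : ℝ) + F ^ 5 - 744 : ℝ)) : ℂ)‖ = (S : ℝ) + F ^ 5 - 744 := by
    rw [Complex.norm_real, Real.norm_eq_abs, abs_of_pos (by linarith)]
  have hn2lo : (263.04 : ℝ) - 1 / 10 ^ 6 ≤ ‖formJ (5, 3, 5)‖ := by
    calc (263.04 : ℝ) - 1 / 10 ^ 6 ≤ ‖((((S : ℝ) + F ^ 5 - 744 : ℝ)) : ℂ)‖ - ‖formJ (1, 1, 23) + (F : ℂ) ^ 5 - 744‖ := by
          rw [e1]; linarith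
      _ ≤ ‖((((S : ℝ) + F ^ 5 - 744 : ℝ)) : ℂ) - (formJ (1, 1, 23) + (F : ℂ) ^ 5 - 744)‖ := norm_sub_norm_le _ _
      _ = ‖formJ (5, 3, 5)‖ := (congrArg Norm.norm hj2').symm
  have hn2hi : ‖formJ (5, 3, 5)‖ ≤ 673.67 + 1 / 10 ^ 6 := by
    calc ‖formJ (5, 3, 5)‖ = ‖((((S : ℝ) + F ^ 5 - 744 : ℝ)) : ℂ) - (formJ (1, 1, 23) + (F : ℂ) ^ 5 - 744)‖ := congrArg Norm.norm hj2'
      _ ≤ ‖((((S : ℝ) + F ^ 5 - 744 : ℝ)) : ℂ)‖ + ‖formJ (1, 1, 23) + (F : ℂ) ^ 5 - 744‖ := norm_sub_le _ _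
      _ ≤ 673.67 + 1 / 10 ^ 6 := by rw [e1]; linarith
  have hval1 : ‖-((F : ℂ) ^ 5) + 744‖ = F ^ 5 - 744 := by
    rw [show -((F : ℂ) ^ 5) + 744 = ((-(F ^ 5) + 744 : ℝ) : ℂ) by push_cast; ring, Complex.norm_real, Real.norm_eq_abs,
      abs_of_neg (by linarith)]
    ring
  have t1 : ‖-((F : ℂ) ^ 5) + 744‖ ≤ ‖formJ (1, 1, 23)‖ + ‖formJ (1, 1, 23) + (F : ℂ) ^ 5 - 744‖ := by
    rw [show -((F : ℂ) ^ 5) + 744 = formJ (1, 1, 23) - (formJ (1, 1, 23) + (F : ℂ) ^ 5 - 744) by ring]; exact norm_sub_le _ _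
  have t1' := norm_add_le (-((F : ℂ) ^ 5) + 744) (formJ (1, 1, 23) + (F : ℂ) ^ 5 - 744)
  rw [show -((F : ℂ) ^ 5) + 744 + (formJ (1, 1, 23) + (F : ℂ) ^ 5 - 744) = formJ (1, 1, 23) by ring] at t1'
  rw [hval1] at t1 t1'
  have hn1lo : F ^ 5 - 744.000001 ≤ ‖formJ (1, 1, 23)‖ := by linarith
  have hn1hi : ‖formJ (1, 1, 23)‖ ≤ F ^ 5 - 743.999999 := by linarith
  have hPlo : (2724848483243186 : ℤ) ≤ |P| := by
    have h : (2724848483243186 : ℝ) ≤ ‖(P : ℂ)‖ := by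
      rw [← hP, norm_mul]
      calc (2724848483243186 : ℝ) ≤ (F ^ 5 - 744.000001) * (263.04 - 1 / 10 ^ 6) := by linarith
        _ ≤ ‖formJ (1, 1, 23)‖ * ‖formJ (5, 3, 5)‖ := mul_le_mul hn1lo hn2lo (by norm_num) (norm_nonneg _)
    rw [Complex.norm_intCast] at h
    exact_mod_cast h
  have hPhi : |P| ≤ (6978608827319140 : ℤ) := by
    have h : ‖(P : ℂ)‖ ≤ (6978608827319140 : ℝ) := by
      rw [← hP, norm_mul]
      calc ‖formJ (1, 1, 23)‖ * ‖formJ (5, 3, 5)‖ ≤ (F ^ 5 - 743.999999) * (673.67 + 1 / 10 ^ 6) :=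
            mul_le_mul hn1hi hn2hi (norm_nonneg _) (by linarith)
        _ ≤ (6978608827319140 : ℝ) := by linarith
    rw [Complex.norm_intCast] at h
    exact_mod_cast h
  -- the SIGN of `P`: `P + (F⁵ − 744)·t = z₁·(t + F⁵ − 744) − z₁²` is tiny against `(F⁵ − 744)·t ≥ 2.7·10¹⁵`
  set t : ℝ := (S : ℝ) + F ^ 5 - 744 with htdef
  set z₁ := formJ (1, 1, 23) + (F : ℂ) ^ 5 - 744 with hz₁
  have hPid : ((((P : ℝ) + (F ^ 5 - 744) * t : ℝ)) : ℂ) = z₁ * (((t + F ^ 5 - 744 : ℝ)) : ℂ) - z₁ ^ 2 := by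
    have e1 : formJ (1, 1, 23) = z₁ - (F : ℂ) ^ 5 + 744 := by rw [hz₁]; ring
    have e2 : formJ (5, 3, 5) = (t : ℂ) - z₁ := by rw [hj2']
    push_cast; rw [← hP, e2, e1, htdef]; push_cast; ring
  have hsmall : |(P : ℝ) + (F ^ 5 - 744) * t| ≤ 1 / 10 ^ 6 * 10359100000000 + (1 / 10 ^ 6) ^ 2 := by
    rw [← Real.norm_eq_abs, ← Complex.norm_real, hPid]
    have ht' : ‖(((t + F ^ 5 - 744 : ℝ)) : ℂ)‖ ≤ 10359100000000 := by
      rw [Complex.norm_real, Real.norm_eq_abs, abs_of_pos (by linarith)]; linarith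
    calc ‖z₁ * (((t + F ^ 5 - 744 : ℝ)) : ℂ) - z₁ ^ 2‖ ≤ ‖z₁ * (((t + F ^ 5 - 744 : ℝ)) : ℂ)‖ + ‖z₁ ^ 2‖ := norm_sub_le _ _
      _ = ‖z₁‖ * ‖(((t + F ^ 5 - 744 : ℝ)) : ℂ)‖ + ‖z₁‖ ^ 2 := by rw [norm_mul, norm_pow]
      _ ≤ 1 / 10 ^ 6 * 10359100000000 + (1 / 10 ^ 6) ^ 2 := by
          gcongr
  have hbig : (2724848483243186 : ℝ) ≤ (F ^ 5 - 744) * t := by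
    have h := mul_le_mul (show (400.9259 : ℝ) ^ 5 - 744 ≤ F ^ 5 - 744 by linarith) htlo (by norm_num) (by linarith)
    exact le_trans (by norm_num) h
  obtain ⟨-, hs2⟩ := abs_le.mp hsmall
  have hPneg : (P : ℝ) < 0 := by linarith
  have hPneg' : P < 0 := by exact_mod_cast hPneg
  rw [abs_of_neg hPneg'] at hPlo hPhi
  exact ⟨S, P, hS, hP, hlo, hhi, by linarith, by linarith⟩

/-- **`|j(τ_{(1,1,23)})| ≥ 10¹³`** (indeed `≈ 1.0359·10¹³`). [cite: GranvilleStark2000, §2 proof of Theorem 1] -/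
theorem norm_formJ_one_one_twentyThree_ge : (10 ^ 13 : ℝ) ≤ ‖formJ (1, 1, 23)‖ := by
  have hw1 := norm_formJ_one_one_twentyThree_add_le
  obtain ⟨hF1, hF2⟩ := exp_bounds
  rw [Real.exp_neg, exp_pi_sqrt_eq_pow] at hw1
  set F := Real.exp (π * √(91 : ℝ) / 5) with hFdef
  have hFpos : 0 < F := Real.exp_pos _
  have hF5 : (400.9259 : ℝ) ^ 5 ≤ F ^ 5 := pow_le_pow_left₀ (by norm_num) hF1 5
  have hF5pos : 0 < F ^ 5 := pow_pos hFpos 5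
  have hb1 : 400000 * (F ^ 5)⁻¹ ≤ 1 / 10 ^ 6 := by rw [← div_eq_mul_inv, div_le_iff₀ hF5pos]; nlinarith
  push_cast at hw1
  have hval1 : ‖-((F : ℂ) ^ 5) + 744‖ = F ^ 5 - 744 := by
    rw [show -((F : ℂ) ^ 5) + 744 = ((-(F ^ 5) + 744 : ℝ) : ℂ) by push_cast; ring, Complex.norm_real, Real.norm_eq_abs,
      abs_of_neg (by linarith)]
    ring
  have t1 : ‖-((F : ℂ) ^ 5) + 744‖ ≤ ‖formJ (1, 1, 23)‖ + ‖formJ (1, 1, 23) + (F : ℂ) ^ 5 - 744‖ := by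
    rw [show -((F : ℂ) ^ 5) + 744 = formJ (1, 1, 23) - (formJ (1, 1, 23) + (F : ℂ) ^ 5 - 744) by ring]; exact norm_sub_le _ _
  rw [hval1] at t1
  linarith

end ClassPolynomialNegNinetyOne

end Literature.NumberTheory.EllipticCurves

end
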